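import Mathlib
import Summits.NavierStokesRegularity.NavierStokesRegularity.Theses.MergerLadder
import Summits.NavierStokesRegularity.NavierStokesRegularity.Theorems.BlowupAssembly
import HarnessLib

/-!
# `MergerLadder.Assembly` — the route's assembly (item stmt-NavierStokesRegularity-1053; pure logic)

**Statement.** `EulerWindowLadderBlowup → ViscousLadderBridge → ClayUniqueness → ¬ NavierStokesRegularity`.

PROOF (the planner's three lines). Apply `ViscousLadderBridge` to `EulerWindowLadderBlowup` to get the
route's target (a maximal smooth Leray–Hopf solution from a rapidly decaying datum with a two-sided
rate), forget the rate conjunct (projection onto `X5a = Blowup.BlowupExists`), and feed the pair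
`⟨X5a, ClayUniqueness⟩` to the accepted glue `Literature.NS.blowup_assembly`
(`Theorems/BlowupAssembly.lean`, item stmt-NavierStokesRegularity-0151).

HONEST FRAMING: glue between the route's own statements (about HYPOTHETICAL blow-ups); nothing
here bears on the regularity problem itself.
-/

noncomputable section

set_option linter.dupNamespace false

namespace Summit.NavierStokesRegularity.NavierStokesRegularity.Theorems

/-- **Item stmt-NavierStokesRegularity-1053** (`MergerLadder.Assembly`): the Euler window ladder
blow-up, the viscous bridge and Clay uniqueness refute `NavierStokesRegularity`, via the accepted
glue `Literature.NS.blowup_assembly` after dropping the rate conjunct. [this file] -/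
theorem mergerLadder_assembly_proof :
    Summit.NavierStokesRegularity.NavierStokesRegularity.Theses.MergerLadder.Assembly := by
  unfold Summit.NavierStokesRegularity.NavierStokesRegularity.Theses.MergerLadder.Assembly
    Summit.NavierStokesRegularity.NavierStokesRegularity.Theses.MergerLadder.EulerWindowLadderBlowup
    Summit.NavierStokesRegularity.NavierStokesRegularity.Theses.MergerLadder.ViscousLadderBridge
    Summit.NavierStokesRegularity.NavierStokesRegularity.Theses.MergerLadder.ClayUniqueness
  intro hE hV hU
  obtain ⟨ν, hν, T, hT, u, p, hmax, hLH, hdec, -⟩ := hV hE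
  exact Literature.NS.blowup_assembly ⟨⟨ν, hν, T, hT, u, p, hmax, hLH, hdec⟩, hU⟩

end Summit.NavierStokesRegularity.NavierStokesRegularity.Theorems

end
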